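/-
Copyright (c) 2026 the pub-hodgecm-mathlib formalisation cell (harness21).  Prover seat hodgecm-mathlib-F0P3a-p04 (g32): E1 row 47d (M4) «ROW-61 DOCK ADAPTERS» (the four one-screen
facts that hand ★ (M3) `exists_mackeyLocalData` and ★ row 60 their last datum-free letters: `N ∩ T ⊴ T`, open kernel of a continuous `ℂˣ`-character, `Stab(x)` preserves `V^{U_x}`, the
torus index along `Subgroup.inclusion`; asked by the row-61 pen F0P2-p06 (g22) 04:31:04Z «as a Literature sibling»), over ★ FILE 5a, ★ `JacquetModule`, ★ `SmoothIndClosedCellNonzero`,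
2026-09-03.
-/
import Literature.NumberTheory.Automorphic.SchneiderStuhlerTreeComplexGlobal   -- ★ 5a: `apply_mem_fixedPoints_act`, `apply_mem_fixedPoints_sup_act`
import Literature.NumberTheory.Automorphic.JacquetModule                      -- `ParabolicTriple`
import Literature.NumberTheory.Automorphic.SmoothIndClosedCellNonzero         -- ★ `exists_openSubgroup_forall_unitsComplex_eq_one` (`ℂˣ` has no small subgroups)
import HarnessLib

/-!
# Row-61 dock adapters: `N ∩ T ⊴ T`, open kernels of continuous `ℂˣ`-characters, stabilisers preserve fixed vectors, the torus index along inclusions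

Topic `NumberTheory/Automorphic`; namespaces `Literature.NumberTheory.Automorphic.ParabolicTriple` (§1) and `Representation` (§2–§4); THEOREMS ONLY (no definition, instance, notation or
named fact); imports ★ FILE 5a, ★ `JacquetModule`, ★ `SmoothIndClosedCellNonzero`, HarnessLib.  Cell `pub/hodgecm-mathlib` (D-0151), crux H413 = `stmt-HodgeConjecture-24833`, lane
`--supports`; E1 row 47d, brick (M4) (sibling of ★ (M2) `SchneiderStuhlerTreeLocalModel`, ★ (M3) `SchneiderStuhlerEPInducedTraceLocalData`).  Count-neutral generic base layer; HC_CM is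
proved only modulo the 7 printed citations (2 remaining named inputs: hLiu418 = `stmt-HodgeConjecture-24832`, h413 = `stmt-HodgeConjecture-24833`) until rung 0 closes.

THE ADAPTERS.  ★ (M3) `exists_mackeyLocalData` asks for `[∀ j, (N j).Normal]` (with `N j = t.N.subgroupOf (T j)`, `T j = B ∩ Stab`), `hχo : IsOpen (χH.ker)` (the inducing character `χ̃ : B →* ℂˣ`)
and `hE′T` (`T j` preserves `E′_j = V^{U_{r_j}}`); ★ row 60's (L2) asks for the torus index `cj : ∀ j, ιC → ↥(C j)` onto `C j = Cg.subgroupOf (T j)`.  All four are datum-free in shape: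
* §1 `ParabolicTriple.normal_N_subgroupOf`: for `T ≤ P`, `N ∩ T` (read as `t.N.subgroupOf T`) is normal in `T` (`P` normalises `N`).
* §2 `isOpen_ker_of_continuous_units` ∕ `isOpen_ker_of_continuous_coe`: a continuous character `φ : B →* ℂˣ` of a subgroup `B` of a non-archimedean group has OPEN KERNEL
  (★ `exists_openSubgroup_forall_unitsComplex_eq_one`: `ℂˣ` has no small subgroups).
* §3 `apply_mem_fixedPoints_of_act_eq` ∕ `apply_mem_fixedPoints_sup_of_act_eq`: an element fixing the vertex `x` (resp. the vertices `x, y`) maps `V^{U_x}` (resp. `V^{U_x ⊔ U_y}`) to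
  itself (★ 5a's transport lemma at `g·x = x`) — the letter `hE′T` at `T j ≤ Stab(r_j)`, in the `∀ t ∈ T, ∀ v ∈ E′, ρ t v ∈ E′` shape.
* §4 `exists_inclusions_subgroupOf`: for `Cg ≤ T j` (all `j`), the maps `cj j : ↥Cg → ↥(Cg.subgroupOf (T j))` over `Γ`, SURJECTIVE — the letters `cj hcj` of ★ row 60 (then `TM c := ρ₀ ↑c`,
  `Tc c := ρ₀.jacquetModule t ⟨c, _⟩`, `hmkT := (jacquetModule_mk …).symm`, `χ′ c := χH ⟨c, _⟩`, `hχ′ := rfl`, `hEN := hE₀` of ★ 5b).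

## References
* [BernsteinZelevinsky1977] I. N. Bernstein, A. V. Zelevinsky, *Induced representations of reductive 𝔭-adic groups I*, Ann. Sci. ÉNS 10 (1977), §1.8, §2.3.
* [CartierCorvallis1979] P. Cartier, *Representations of 𝔭-adic groups: a survey*, Proc. Sympos. Pure Math. 33 (1979), Part 1, §I.1 (smooth characters, no small subgroups).
* [SchneiderStuhler1997] P. Schneider, U. Stuhler, *Representation theory and sheaves on the Bruhat–Tits building*, Publ. Math. IHÉS 85 (1997), Ch. III §4.
-/

set_option autoImplicit false

/-! ## §1 `N ∩ T` is normal in `T ≤ P` -/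

namespace Literature.NumberTheory.Automorphic.ParabolicTriple

/-- **`N ∩ T ⊴ T` FOR `T ≤ P`**: the subgroup `t.N.subgroupOf T` of `↥T` is normal, because `P` normalises `N` (the instance `[∀ j, (N j).Normal]` of ★ (M3) at `T j = B ∩ Stab(r_j)`,
`N j = t.N.subgroupOf (T j)`). [cite: BernsteinZelevinsky1977, §1.8] -/
theorem normal_N_subgroupOf {G : Type*} [Group G] (t : ParabolicTriple G) (T : Subgroup G) (hT : T ≤ t.P) : (t.N.subgroupOf T).Normal := by
  refine ⟨fun n hn x => ?_⟩
  rw [Subgroup.mem_subgroupOf] at hn ⊢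
  have hx : (x : G) ∈ Subgroup.normalizer (t.N : Set G) := t.le_normalizer (hT x.2)
  rw [Subgroup.mem_normalizer_iff] at hx
  rw [Subgroup.coe_mul, Subgroup.coe_mul, Subgroup.coe_inv]
  exact (hx _).1 hn

end Literature.NumberTheory.Automorphic.ParabolicTriple

namespace Representation

open Function Literature.NumberTheory.Automorphic

/-! ## §2 Continuous `ℂˣ`-characters of subgroups of non-archimedean groups have open kernel -/

section OpenKernel

variable {G : Type*} [Group G] [TopologicalSpace G] [NonarchimedeanGroup G] (B : Subgroup G) (φ : B →* ℂˣ)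

/-- **A CONTINUOUS CHARACTER `φ : B →* ℂˣ` OF A SUBGROUP OF A NON-ARCHIMEDEAN GROUP HAS OPEN KERNEL** (continuity asked of `b ↦ (φ b : ℂ)`): `φ` is trivial on `B ∩ K` for an open
subgroup `K` of the ambient group (★ `exists_openSubgroup_forall_unitsComplex_eq_one`), and `B ∩ K` is open in `B` — the letter `hχo` of ★ (M3) for the inducing character `χ̃` of `B`.
[cite: CartierCorvallis1979, §I.1] -/
theorem isOpen_ker_of_continuous_coe (hφ : Continuous fun b : B => ((φ b : ℂˣ) : ℂ)) : IsOpen (φ.ker : Set B) := by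
  obtain ⟨K, hK⟩ := exists_openSubgroup_forall_unitsComplex_eq_one B φ hφ
  have hle : (K : Subgroup G).comap B.subtype ≤ φ.ker := fun b hb => by
    rw [MonoidHom.mem_ker]
    exact hK b hb
  refine Subgroup.isOpen_mono hle ?_
  rw [Subgroup.coe_comap]
  exact K.isOpen.preimage continuous_subtype_val

/-- The same with continuity asked of `φ : B → ℂˣ` itself. [cite: CartierCorvallis1979, §I.1] -/
theorem isOpen_ker_of_continuous_units (hφ : Continuous φ) : IsOpen (φ.ker : Set B) :=
  isOpen_ker_of_continuous_coe B φ (Units.continuous_val.comp hφ)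

end OpenKernel

/-! ## §3 Stabilisers preserve fixed vectors -/

section Stable

variable {k Γ V : Type*} [Field k] [Group Γ] [AddCommGroup V] [Module k V] {ρ : Representation k Γ V}
variable {ι : Type*} {G : SimpleGraph ι} {a : Γ →* (G ≃g G)} {U : ι → Subgroup Γ}
  (hUa : ∀ (g : Γ) (x : ι), U (a g x) = (U x).map (MulAut.conj g).toMonoidHom)

include hUa in
/-- **AN ELEMENT FIXING THE VERTEX `x` PRESERVES `V^{U_x}`** (★ 5a `apply_mem_fixedPoints_act` at `g·x = x`) — the letter `hE′T` of ★ (M3) for `T j ≤ Stab(r_j)`, stated for any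
subgroup `T` of the stabiliser in the `∀ t ∈ T, ∀ v ∈ E′, ρ t v ∈ E′` shape. [cite: SchneiderStuhler1997, Ch. III §4] -/
theorem apply_mem_fixedPoints_of_act_eq (x : ι) (T : Subgroup Γ) (hT : ∀ g ∈ T, a g x = x) :
    ∀ g ∈ T, ∀ v ∈ ρ.fixedPoints (U x), ρ g v ∈ ρ.fixedPoints (U x) := fun g hg v hv => by
  have h := apply_mem_fixedPoints_act (ρ := ρ) hUa g hv
  rwa [hT g hg] at h

include hUa in
/-- **AN ELEMENT FIXING THE VERTICES `x, y` PRESERVES `V^{U_x ⊔ U_y}`** (the edge twin, ★ 5a `apply_mem_fixedPoints_sup_act`). [cite: SchneiderStuhler1997, Ch. III §4] -/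
theorem apply_mem_fixedPoints_sup_of_act_eq (x y : ι) (T : Subgroup Γ) (hTx : ∀ g ∈ T, a g x = x) (hTy : ∀ g ∈ T, a g y = y) :
    ∀ g ∈ T, ∀ v ∈ ρ.fixedPoints (U x ⊔ U y), ρ g v ∈ ρ.fixedPoints (U x ⊔ U y) := fun g hg v hv => by
  have h := apply_mem_fixedPoints_sup_act (ρ := ρ) hUa g hv
  rwa [hTx g hg, hTy g hg] at h

end Stable

/-! ## §4 The torus index along inclusions -/

section TorusIndex

variable {Γ : Type*} [Group Γ]

/-- **THE TORUS INDEX ALONG `Subgroup.inclusion`**: for `Cg ≤ T j` (all `j`) there are maps `cj j : ↥Cg → ↥(Cg.subgroupOf (T j))` over `Γ`, SURJECTIVE — the letters `cj hcj` of ★ row 60's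
(L2) at `ιC := ↥Cg` (`Cg = T_c` the compact torus, `C j = Cg.subgroupOf (T j)` as in ★ 55-B-3a `borelDoubleCoset_vertex`). [cite: BernsteinZelevinsky1977, §2.3] -/
theorem exists_inclusions_subgroupOf {ι : Type*} (Cg : Subgroup Γ) (T : ι → Subgroup Γ) (h : ∀ j, Cg ≤ T j) :
    ∃ cj : ∀ j, ↥Cg → ↥(Cg.subgroupOf (T j)),
      (∀ j, Surjective (cj j)) ∧ ∀ (j : ι) (c : Cg), (((cj j c : Cg.subgroupOf (T j)) : T j) : Γ) = (c : Γ) := by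
  refine ⟨fun j c => ⟨⟨(c : Γ), h j c.2⟩, Subgroup.mem_subgroupOf.2 c.2⟩, fun j s => ?_, fun j c => rfl⟩
  exact ⟨⟨((s : T j) : Γ), Subgroup.mem_subgroupOf.1 s.2⟩, Subtype.ext (Subtype.ext rfl)⟩

/-- A surjective torus index on a general `C j ≤ T j`: if every element of `C j` comes from `Cg` (`hCj`), the same maps work — the variant for (X3) packages that present `C j` by a
membership predicate rather than as `Cg.subgroupOf (T j)`. [cite: BernsteinZelevinsky1977, §2.3] -/
theorem exists_maps_onto_subgroups_of_coe_mem {ι : Type*} (Cg : Subgroup Γ) (T : ι → Subgroup Γ) (h : ∀ j, Cg ≤ T j) (C : ∀ j, Subgroup (T j))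
    (hC : ∀ (j : ι) (c : Cg), (⟨(c : Γ), h j c.2⟩ : T j) ∈ C j) (hCj : ∀ (j : ι) (s : C j), ((s : T j) : Γ) ∈ Cg) :
    ∃ cj : ∀ j, ↥Cg → ↥(C j), (∀ j, Surjective (cj j)) ∧ ∀ (j : ι) (c : Cg), (((cj j c : C j) : T j) : Γ) = (c : Γ) := by
  refine ⟨fun j c => ⟨⟨(c : Γ), h j c.2⟩, hC j c⟩, fun j s => ?_, fun j c => rfl⟩
  exact ⟨⟨((s : T j) : Γ), hCj j s⟩, Subtype.ext (Subtype.ext rfl)⟩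

end TorusIndex

end Representation
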